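import Summits.AtomisticToContinuum.Crystallization.Theorems.FreeSplittingCertificatesStrictSplittingRuleP1LedgerGauge

/-!
# `StrictSplittingRule` (stmt-AtomisticToContinuum-12560): DEFLATION REMOVAL — a coercive gauged-and-deflated ledger gives the near form nonnegative on the least-squares constraint set (P1 interpolant object, part 107)

Route `FreeSplittingCertificates`, crux r3 `StrictSplittingRule` (H12⋆ = `stub_coreJointCoercive`), unit b2b-freesplit-B gen 52.
VALUE = the kernel form of the reduction `(C7)` + rigid handling of the near certificate (HOME CERT §41 (a), §48): nearcert v10 certifies the
DEFLATED ledger `X(u) = Q(v(u)) + γ·Σ_k (R_k·u)²/‖R_k‖²` coercive (`⪰ m·G`) on UNCONSTRAINED displacements `u` of the active site set `S`, where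
`v(u)` is the gauge substitution `p1Vals` (part 106) and the six `R_k` are nearcert's rigid-motion functionals (`p1RigMom`, `p1Defl`); the kernel's
(NC∃′) wants `0 ≤ Q(V)` for the lattice values `V` on the least-squares CONSTRAINT SET (`V p = 0`, first-shell moment condition).
**`nearForm_nonneg_of_ledger_coercive`**: for ANY functional `Q` of the lattice values, if `c·Σ_{q∈S}‖u_q‖² ≤ Q(v(u)) + p1Defl S u` for all `u`
with `c > 0`, and `S` contains `p` and two sites `q₁, q₂` with `(y_{q₁} − y_p) × (y_{q₂} − y_p) ≠ 0`, then `0 ≤ Q(V)` on the constraint set.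
Proof: the linear map `L : ℝ⁶ → ℝ⁶`, `(t, ω) ↦` the six deflation functionals of the rigid field `q ↦ t + ω × (y_q − y_p)`, is injective — a
rigid field in its kernel is gauged to zero (`p1Vals_p1Rigid`) and not deflated, so coercivity along its multiples forces it to vanish on `S`, whence
`t = 0` (at `p`) and `ω = 0` (`cross_eq_zero_of_cross_pair`) —, hence surjective (`LinearMap.injective_iff_surjective`): some rigid `r` has the
same six functionals as `V`; then `w = V − r` is undeflated, `v(w) = v(V) = V` (`p1Vals_eq_self`, `p1Vals_p1Rigid`), and `0 ≤ c‖w‖² ≤ Q(V)`.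
No normalisation, frame or data of the deflation enters beyond "six linear functionals nondegenerate on the rigid motions".
NOT a proof of H12⋆, NOT summit progress.  [folklore: finite-dimensional linear algebra]
-/

noncomputable section

open scoped BigOperators Matrix
open Finset

namespace Summit.AtomisticToContinuum.Crystallization.Theorems.StrictSplittingRuleBirth

open Literature.MathematicalPhysics.StatisticalMechanics
open Summit.AtomisticToContinuum.Crystallization.Theorems.PalmUnimodularRigidity.LayeredLawsSelectHcp

/-- **Two independent directions pin a rotation vector**: `ω × d₁ = 0`, `ω × d₂ = 0` and `d₁ × d₂ ≠ 0` force `ω = 0`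
(nine trilinear identities `ω_i (d₁ × d₂)_k ∈ span{(ω × d₁)_j, (ω × d₂)_j}`). [folklore] -/
theorem cross_eq_zero_of_cross_pair {ω d₁ d₂ : Fin 3 → ℝ} (h1 : ω ⨯₃ d₁ = 0) (h2 : ω ⨯₃ d₂ = 0) (hn : d₁ ⨯₃ d₂ ≠ 0) :
    ω = 0 := by
  have h10 : ω 1 * d₁ 2 - ω 2 * d₁ 1 = 0 := by have := congrFun h1 0; simpa [cross_apply] using this
  have h11 : ω 2 * d₁ 0 - ω 0 * d₁ 2 = 0 := by have := congrFun h1 1; simpa [cross_apply] using this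
  have h12 : ω 0 * d₁ 1 - ω 1 * d₁ 0 = 0 := by have := congrFun h1 2; simpa [cross_apply] using this
  have h20 : ω 1 * d₂ 2 - ω 2 * d₂ 1 = 0 := by have := congrFun h2 0; simpa [cross_apply] using this
  have h21 : ω 2 * d₂ 0 - ω 0 * d₂ 2 = 0 := by have := congrFun h2 1; simpa [cross_apply] using this
  have h22 : ω 0 * d₂ 1 - ω 1 * d₂ 0 = 0 := by have := congrFun h2 2; simpa [cross_apply] using this
  have key : ∀ i k : Fin 3, ω i * (d₁ ⨯₃ d₂) k = 0 := by
    intro i k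
    fin_cases i <;> fin_cases k <;>
      simp only [cross_apply, Fin.isValue, Fin.zero_eta, Fin.mk_one, Fin.reduceFinMk, Matrix.cons_val_zero, Matrix.cons_val_one,
        Matrix.cons_val]
    · linear_combination d₂ 1 * h11 + d₂ 2 * h12 + d₁ 0 * h20
    · linear_combination (-d₂ 0) * h11 + d₁ 0 * h21
    · linear_combination (-d₂ 0) * h12 + d₁ 0 * h22
    · linear_combination (-d₂ 1) * h10 + d₁ 1 * h20
    · linear_combination d₂ 0 * h10 + d₂ 2 * h12 + d₁ 1 * h21
    · linear_combination (-d₂ 1) * h12 + d₁ 1 * h22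
    · linear_combination (-d₂ 2) * h10 + d₁ 2 * h20
    · linear_combination (-d₂ 2) * h11 + d₁ 2 * h21
    · linear_combination (-d₂ 2) * h12 - d₁ 0 * h20 - d₁ 1 * h21
  obtain ⟨k, hk⟩ := Function.ne_iff.1 hn
  funext i
  exact (mul_eq_zero.1 (key i k)).resolve_right hk

/-- **DEFLATION REMOVAL / THE NEAR REDUCTION IN THE KERNEL.**  See the module docstring.  `Q` is an arbitrary functional of the lattice values
(instantiated with the booked finite near form); the hypothesis `hX` is the conclusion of the grid + box tiers (`X ⪰ (m_min − ρ)·G` on the box);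
`S` = the active site set of the certificate (any finite set containing `p` and two sites not collinear with `p`).  NOT a proof of H12⋆, NOT summit
progress. [folklore] -/
theorem nearForm_nonneg_of_ledger_coercive {a h : ℝ} (ha : 0 < a) (p : ℤ × ℤ × ℤ) (S : Finset (ℤ × ℤ × ℤ)) (hpS : p ∈ S)
    {q₁ q₂ : ℤ × ℤ × ℤ} (hq₁ : q₁ ∈ S) (hq₂ : q₂ ∈ S) (hx : p1Rel a h p q₁ ⨯₃ p1Rel a h p q₂ ≠ 0)
    (Q : (ℤ × ℤ × ℤ → (Fin 3 → ℝ)) → ℝ) {c : ℝ} (hc : 0 < c)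
    (hX : ∀ u : ℤ × ℤ × ℤ → (Fin 3 → ℝ), c * p1NormSq S u ≤ Q (p1Vals a h p (p1StarAt p) u) + p1Defl a h p S u)
    {V : ℤ × ℤ × ℤ → (Fin 3 → ℝ)} (hVp : V p = 0)
    (hmom : ∀ Z : Fin 3 → Fin 3 → ℝ, (∀ j k, Z j k = -Z k j) →
      ∑ q ∈ p1StarAt p, ∑ k : Fin 3, V q k * (∑ j : Fin 3, (hcpSite a h q j - hcpSite a h p j) * Z j k) = 0) :
    0 ≤ Q V := by
  -- the six deflation functionals of the rigid fields, as a linear endomorphism of ℝ⁶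
  let L : (Fin 6 → ℝ) →ₗ[ℝ] (Fin 6 → ℝ) :=
    { toFun := fun cc => p1RigMom a h p S (p1Rigid a h p cc)
      map_add' := fun x y => by
        have e1 : p1Rigid a h p (x + y) - p1Rigid a h p y = p1Rigid a h p x := by
          rw [← p1Rigid_sub, add_sub_cancel_right]
        have e2 := p1RigMom_sub a h p S (p1Rigid a h p (x + y)) (p1Rigid a h p y)
        rw [e1] at e2
        rw [e2, sub_add_cancel]
      map_smul' := fun t x => by
        simp only [p1Rigid_smul, p1RigMom_smul, RingHom.id_apply] }
  -- (1) L is injective: a rigid field with vanishing functionals is gauged to zero and undeflated, so coercivity kills it on S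
  have hinj : Function.Injective L := by
    refine (injective_iff_map_eq_zero L).2 fun cc hcc => ?_
    have hcc' : p1RigMom a h p S (p1Rigid a h p cc) = 0 := hcc
    set r := p1Rigid a h p cc with hr
    have hnorm : p1NormSq S r = 0 := by
      by_contra hne
      have hpos : 0 < p1NormSq S r := lt_of_le_of_ne (p1NormSq_nonneg S r) (Ne.symm hne)
      have hcn : 0 < c * p1NormSq S r := mul_pos hc hpos
      set K : ℝ := (|Q 0| + 1) / (c * p1NormSq S r) + 1 with hK
      have hK0 : 0 ≤ (|Q 0| + 1) / (c * p1NormSq S r) := by positivity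
      have hK1 : 1 ≤ K := by rw [hK]; linarith
      have hXt := hX (K • r)
      have hV0 : p1Vals a h p (p1StarAt p) (K • r) = 0 := by
        rw [p1Vals_smul, hr, p1Vals_p1Rigid ha, smul_zero]
      have hD0 : p1Defl a h p S (K • r) = 0 :=
        p1Defl_eq_zero_of_rigMom a h p S (by rw [p1RigMom_smul, hcc', smul_zero])
      rw [hV0, hD0, add_zero, p1NormSq_smul] at hXt
      -- hXt : c * (K ^ 2 * ‖r‖²_S) ≤ Q 0, but c‖r‖²·K² ≥ c‖r‖²·K = |Q 0| + 1 + c‖r‖² > Q 0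
      have h1 : c * p1NormSq S r * K ≤ c * (K ^ 2 * p1NormSq S r) := by
        have : c * p1NormSq S r * K * 1 ≤ c * p1NormSq S r * K * K :=
          mul_le_mul_of_nonneg_left hK1 (by positivity)
        nlinarith
      have h2 : c * p1NormSq S r * K = (|Q 0| + 1) + c * p1NormSq S r := by
        rw [hK]; field_simp
      have h3 : Q 0 ≤ |Q 0| := le_abs_self _
      linarith
    have hrS : ∀ q ∈ S, r q = 0 := fun q hq => eq_zero_of_p1NormSq_eq_zero hnorm hq
    have ht : (![cc 0, cc 1, cc 2] : Fin 3 → ℝ) = 0 := by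
      have := hrS p hpS
      simpa [hr, p1Rigid, p1Rel_self] using this
    have hω1 : ![cc 3, cc 4, cc 5] ⨯₃ p1Rel a h p q₁ = 0 := by
      have := hrS q₁ hq₁
      simpa [hr, p1Rigid, ht] using this
    have hω2 : ![cc 3, cc 4, cc 5] ⨯₃ p1Rel a h p q₂ = 0 := by
      have := hrS q₂ hq₂
      simpa [hr, p1Rigid, ht] using this
    have hω := cross_eq_zero_of_cross_pair hω1 hω2 hx
    funext k
    fin_cases k
    · have := congrFun ht 0; simpa using this
    · have := congrFun ht 1; simpa using this
    · have := congrFun ht 2; simpa using this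
    · have := congrFun hω 0; simpa using this
    · have := congrFun hω 1; simpa using this
    · have := congrFun hω 2; simpa using this
  -- (2) hence surjective: a rigid field with the same six functionals as V
  have hsurj : Function.Surjective L := LinearMap.injective_iff_surjective.1 hinj
  obtain ⟨cc, hcc⟩ := hsurj (p1RigMom a h p S V)
  have hcc' : p1RigMom a h p S (p1Rigid a h p cc) = p1RigMom a h p S V := hcc
  set w := V - p1Rigid a h p cc with hw
  have hw0 : p1RigMom a h p S w = 0 := by
    rw [hw, p1RigMom_sub, hcc', sub_self]
  have hDw : p1Defl a h p S w = 0 := p1Defl_eq_zero_of_rigMom a h p S hw0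
  have hVw : p1Vals a h p (p1StarAt p) w = V := by
    rw [hw, p1Vals_sub, p1Vals_p1Rigid ha, sub_zero, p1Vals_eq_self hVp hmom]
  have key := hX w
  rw [hVw, hDw, add_zero] at key
  exact le_trans (mul_nonneg hc.le (p1NormSq_nonneg S w)) key

end Summit.AtomisticToContinuum.Crystallization.Theorems.StrictSplittingRuleBirth

end
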